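import Literature.MeasureTheory.Group.QuotientOrbitalIntegralProperContinuity   -- ★ (HYP) currency: `descConj`, `continuousOn_integral_descConj_of_uniformlyProper`
import Literature.NumberTheory.Automorphic.ArchLocalTorusOrbitalBlockSmooth       -- ★ Hörmander engine `contDiffAt_integral_comp_of_contDiff_of_support`
import HarnessLib

/-!
# Uniform properness modulo `M` ⇒ the quotient orbital integral is `C^∞` on the regular set

Generic measure-theory support file (THEOREMS ONLY).  The `C^∞` companion of ★
`Literature.MeasureTheory.Group.continuousOn_integral_descConj_of_uniformlyProper`: let `G` be a topological group,
`M ≤ G` a subgroup, `c : V → G` a chart of elements commuting with `M` on a finite-dimensional real parameter space `V`,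
`S ⊆ V` open, and assume the uniform properness (HYP) of the conjugation `(x, yM) ↦ y · c(x) · y⁻¹` on compacts of `S`.
If the orbital integrand FACTORS SMOOTHLY — there are a continuous `M`-right-invariant datum `p : G → P` (a normed space)
and a jointly smooth `Ψ : P × V → F` with `a (y · c(x) · y⁻¹) = Ψ (p y, x)` — and `a` has compact support, then for EVERY
measure `μ` on `G ⧸ M` finite on compacts the quotient orbital integral `x ↦ ∫_{G ⧸ M} a (y · c(x) · y⁻¹) dμ(yM)` is `C^∞`
on `S` (Hörmander, *ALPDO I*, Thm. 1.1.9: near `x₀ ∈ S` the integrands for `x` in a compact neighbourhood `K ⊆ S` are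
supported in ONE compact `𝒦 ⊆ G ⧸ M` by (HYP), and the tree's ★ `contDiffAt_integral_comp_of_contDiff_of_support` differentiates
under the integral sign).  In the application (`G = H_∞`, `M = T_S` a Cartan, `c = endoTorus S`) the datum is
`p(y) = Ad(y) ∘ π` for a linear projection `π` onto the commutant of `M`, and `Ψ(B, x) = Θ(B(c(x)))` for the ambient smooth
`Θ` of the test function (Harish-Chandra: orbital integrals are smooth on the regular set).

References: Hörmander, *The Analysis of Linear Partial Differential Operators I* (1990), Thm. 1.1.9; Deitmar–Echterhoff,
*Principles of Harmonic Analysis* (2014), Lemma 9.3.3; Varadarajan, *Harmonic Analysis on Semisimple Lie Groups* (1989), §2.4 Thm. 8.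
-/

set_option autoImplicit false

noncomputable section

open MeasureTheory MeasureTheory.Measure Set Topology Filter
open scoped ContDiff

namespace Literature.MeasureTheory.Group

section Smooth

variable {G : Type*} [Group G] [TopologicalSpace G]
  {V : Type*} [NormedAddCommGroup V] [NormedSpace ℝ V] [FiniteDimensional ℝ V]
  {P : Type*} [NormedAddCommGroup P] [NormedSpace ℝ P]
  {F : Type*} [NormedAddCommGroup F] [NormedSpace ℝ F] [CompleteSpace F]

/-- **An `M`-right-invariant continuous datum descends continuously to `G ⧸ M`** (the open quotient map `mk`).
[cite: DeitmarEchterhoff2014, Lemma 9.3.3] -/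
theorem continuous_quotient_liftOn'_of_forall_mul_mem (M : Subgroup G) {Y : Type*} [TopologicalSpace Y] (p : G → Y) (hp : Continuous p)
    (hpM : ∀ y, ∀ m ∈ M, p (y * m) = p y) :
    ∃ pbar : G ⧸ M → Y, Continuous pbar ∧ ∀ y, pbar (QuotientGroup.mk y) = p y := by
  have hwd : ∀ a b : G, QuotientGroup.leftRel M a b → p a = p b := by
    intro a b hab
    rw [QuotientGroup.leftRel_apply] at hab
    have h := hpM a _ hab
    rw [mul_inv_cancel_left] at h
    exact h.symm
  refine ⟨fun q => Quotient.liftOn' q p hwd, ?_, fun _ => rfl⟩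
  exact hp.quotient_liftOn' hwd

/-- **UNIFORM PROPERNESS MODULO `M` + A SMOOTH FACTORISATION OF THE INTEGRAND ⇒ THE QUOTIENT ORBITAL INTEGRAL IS `C^∞` ON THE
REGULAR SET.**  `c : V → G` a chart of elements commuting with `M` (`V` finite-dimensional), `S ⊆ V` open with (HYP) on its compacts,
`a : G → F` compactly supported with `a (y · c x · y⁻¹) = Ψ (p y, x)` for a continuous `M`-right-invariant `p : G → P` and a smooth
`Ψ : P × V → F`; then `x ↦ ∫_{G ⧸ M} a (y · c x · y⁻¹) dμ` is `ContDiffOn ℝ ∞` on `S` for every `μ` finite on compacts.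
[cite: HormanderALPDO1, Thm. 1.1.9] [cite: DeitmarEchterhoff2014, Lemma 9.3.3] [cite: Varadarajan1989, §2.4 Thm. 8] -/
theorem contDiffOn_integral_descConj_of_uniformlyProper
    (M : Subgroup G) {c : V → G} (hcomm : ∀ x, ∀ m ∈ M, m * c x = c x * m)
    {S : Set V} (hS : IsOpen S)
    (hprop : ∀ K ⊆ S, IsCompact K → ∀ C : Set G, IsCompact C →
      ∃ 𝒦 : Set (G ⧸ M), IsCompact 𝒦 ∧ ∀ x ∈ K, ∀ y : G, y * c x * y⁻¹ ∈ C → (QuotientGroup.mk y : G ⧸ M) ∈ 𝒦)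
    [MeasurableSpace (G ⧸ M)] [OpensMeasurableSpace (G ⧸ M)] [T2Space (G ⧸ M)]
    (μ : Measure (G ⧸ M)) [IsFiniteMeasureOnCompacts μ]
    {a : G → F} (hac : HasCompactSupport a)
    (p : G → P) (hp : Continuous p) (hpM : ∀ y, ∀ m ∈ M, p (y * m) = p y)
    (Ψ : P × V → F) (hΨ : ContDiff ℝ ∞ Ψ) (hfac : ∀ y x, a (y * c x * y⁻¹) = Ψ (p y, x)) :
    ContDiffOn ℝ ∞ (fun x => ∫ q, descConj (c x) M (hcomm x) a q ∂μ) S := by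
  obtain ⟨pbar, hpbar, hpbar_mk⟩ := continuous_quotient_liftOn'_of_forall_mul_mem M p hp hpM
  -- the integrand, read through the factorisation
  have hint : ∀ x, (fun q => descConj (c x) M (hcomm x) a q) = fun q => Ψ (pbar q, x) := by
    intro x
    funext q
    induction q using QuotientGroup.induction_on with
    | H y => rw [descConj_mk, hfac, hpbar_mk]
  have hEq : (fun x => ∫ q, descConj (c x) M (hcomm x) a q ∂μ) = fun x => ∫ q, Ψ (pbar q, x) ∂μ := by
    funext x
    rw [hint x]
  rw [hEq]
  intro x₀ hx₀
  obtain ⟨K, hKnhds, hKsub, hK⟩ := local_compact_nhds (hS.mem_nhds hx₀)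
  obtain ⟨𝒦, h𝒦, hmem⟩ := hprop K hKsub hK (tsupport a) hac.isCompact
  have h0 : ∀ q ∉ 𝒦, ∀ x ∈ K, Ψ (pbar q, x) = 0 := by
    intro q hq x hx
    induction q using QuotientGroup.induction_on with
    | H y =>
      rw [hpbar_mk, ← hfac]
      by_contra hne
      exact hq (hmem x hx y (subset_tsupport _ (Function.mem_support.2 hne)))
  exact (Literature.Analysis.Calculus.contDiffAt_integral_comp_of_contDiff_of_support μ Ψ hΨ pbar hpbar x₀ h𝒦 hKnhds h0).contDiffWithinAt

/-- **The everywhere-proper case** (e.g. `c` ranges over regular elements only): (HYP) on all of `V` ⇒ the quotient orbital integral is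
`C^∞` on `V`. [cite: HormanderALPDO1, Thm. 1.1.9] [cite: DeitmarEchterhoff2014, Lemma 9.3.3] -/
theorem contDiff_integral_descConj_of_uniformlyProper
    (M : Subgroup G) {c : V → G} (hcomm : ∀ x, ∀ m ∈ M, m * c x = c x * m)
    (hprop : ∀ K : Set V, IsCompact K → ∀ C : Set G, IsCompact C →
      ∃ 𝒦 : Set (G ⧸ M), IsCompact 𝒦 ∧ ∀ x ∈ K, ∀ y : G, y * c x * y⁻¹ ∈ C → (QuotientGroup.mk y : G ⧸ M) ∈ 𝒦)
    [MeasurableSpace (G ⧸ M)] [OpensMeasurableSpace (G ⧸ M)] [T2Space (G ⧸ M)]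
    (μ : Measure (G ⧸ M)) [IsFiniteMeasureOnCompacts μ]
    {a : G → F} (hac : HasCompactSupport a)
    (p : G → P) (hp : Continuous p) (hpM : ∀ y, ∀ m ∈ M, p (y * m) = p y)
    (Ψ : P × V → F) (hΨ : ContDiff ℝ ∞ Ψ) (hfac : ∀ y x, a (y * c x * y⁻¹) = Ψ (p y, x)) :
    ContDiff ℝ ∞ fun x => ∫ q, descConj (c x) M (hcomm x) a q ∂μ := by
  rw [← contDiffOn_univ]
  exact contDiffOn_integral_descConj_of_uniformlyProper M hcomm isOpen_univ (fun K _ hK C hC => hprop K hK C hC) μ hac p hp hpM Ψ hΨ hfac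

end Smooth

end Literature.MeasureTheory.Group

end
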